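/-
COR-CM (cell pub-hodgecm2) — ¬hJ RUSH, HEAD-A at a `PhiMu` character ((P-N.d), LEAD decision pub-hodgecm2/INBOX l.19195; planner (N5)∕N298),
pen nothj-p5 (prover-pub-hodgecm2-nothj-p5-g0-0).  THEOREMS ONLY (kernel lane); no `def`, no `sorry`; nothing landed is edited or restated.
FRAMING: HC_CM is NOT proved; «Δ2 BRIDGE CLOSED» is NOT claimed; nothing here asserts hJ, hJ₀ or their negations; `J₁` is a HYPOTHESIS.
-/
import Summits.HodgeConjecture.CorCM.D2Bridge.AdapterMuConjByValue
import Summits.HodgeConjecture.CorCM.D2Bridge.OrientationT2MuConjTowerAdapterIota1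
import HarnessLib

set_option autoImplicit false

/-!
# ¬hJ₀ (HEAD-A, `PhiMu` character) — socket 1∕2: the tree's PIN `componentAlbanesePinTotal` at instance `ῑ₁`

For a weight-one conjugate-symplectic `μ` with `ι₁ ∈ Φ_μ` (e.g. `μ := muOfInvType ι₁ Φ`), the `ι₁`-PRESENTED one-object rest
`U.rest (restTailOne (AlgHom.id ℚ L) ι₁ hμ hw Car …)` over the App.-C datum of record `Model.sec42DataOf h iso (pkgF L) ι₁ (pkgV V) Φ`, `τ' := ι₁`:
the (4.2)∕(4.3) record of the tree's ✔ `componentAlbanesePinTotal` (instance `ῑ₁ = conj ∘ ι₁`) read into the tower by `jHPin = id`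
(injective, equivariant), with the (d)-pieces below the threshold keyed `IsReflexOfTypeG ῑ₁ Φ_μ` (✔ `nonempty_hcmPieces_atUniformRest_conjInst`,
`hadm' := id`; one-index dictionary with trivial theta-side carriers).  Their CM classes are of Hodge type `(0,1)` (own-crow's parity statement
✔ `tau_notMem_cmType_of_isReflexOfType_starRingEnd_comp`), used by the head leaf `OrientationT2NotHJOfMultOnePhiMu`.
[Liu2021] Y. Liu, *Fourier–Jacobi cycles and arithmetic relative trace formula*, Camb. J. Math. 9 (2021): proof of Thm. 4.18, map (4.2)∕(4.3).
-/

noncomputable section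

open scoped TensorProduct DirectSum

namespace Summit.HodgeConjecture.CorCM.D2Bridge.NotHJ

open NumberField
open HodgeCM HodgeCM.Model HodgeCM.Model.TowerCarrier HodgeCM.Model.TowerLevel
open HodgeCM.Literature.Theta HodgeCM.Literature.Theta.LiuAlbaneseModuleDatum
open HodgeCM.Literature.Theta.LiuAlbaneseModuleDatum.D2Bridge (HcmPieces hcm_of_pieces)
open Literature.AlgebraicGeometry.Motives (CMType)
open Literature.AlgebraicGeometry.HodgeTheory Literature.NumberTheory.Automorphic.PicardCM
open Literature.AlgebraicGeometry.ShimuraVarieties.UnitaryCanonicalModel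
open Literature.NumberTheory.Automorphic
open Literature.NumberTheory.Automorphic.Liu2021 Literature.NumberTheory.Automorphic.Liu2021.AppendixC
open Literature.NumberTheory.Automorphic.Liu2021.AppendixC.RestOne
open Literature.NumberTheory.Transcendental (Arapura2012_Cor_15_4_6)


section HeadPhiMu

variable {L : HodgeCM.CMField} {ι₁ : (L : Type) →+* ℂ}

set_option synthInstance.maxHeartbeats 400000 in
set_option maxHeartbeats 3200000 in
/-- **The PIN socket at a `PhiMu` character**: the (4.2)∕(4.3) record of the tree's ✔ `componentAlbanesePinTotal` (instance `ῑ₁`) over the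
`ι₁`-PRESENTED one-object rest of `μ` (`τ' := ι₁ ∈ Φ_μ`), read into the tower by `jHPin = id` (injective, equivariant), with the (d)-pieces
below the threshold keyed `IsReflexOfTypeG ῑ₁ Φ_μ` (✔ `nonempty_hcmPieces_atUniformRest_conjInst`, `hadm' := id`).  Nothing displayed.
[cite: Liu2021, proof of Thm. 4.18 map (4.2)∕(4.3) (FJcycle.tex l. 2247–2253), Thm. 4.18 (1), Lem. 2.4 (1), Def. 4.5 (2), Prop. 4.6 (1)] -/
theorem pinSocket_phiMu
    {hHD : exists_isReal_hodgeModel} {hI : hodgePQ_independent_of_hodgeModel}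
    {h₁ : BallQuotientUniformised} {h₃ : CMAbelianVarietyRealised} {hA : Arapura2012_Cor_15_4_6}
    [IsGalois ℚ (L : Type)] (hU7 : heckeTranslate_definedOver) (V : HodgeCM.HermSpace3 L ι₁) (h : exists_recordSystem)
    (h4 : 4 ≤ Module.finrank ℚ L) (Φ : CMType (pkgF L))
    (iso : ∀ (F : Summit.HodgeConjecture.CorCM.CMField) (ι : F →+* ℂ) (_ : Summit.HodgeConjecture.CorCM.HermSpace3 F ι)
      (_ : CMType F), ℕ → Prop)
    (U : UniformOmega (Model.sec42DataOf h iso (pkgF L) ι₁ (pkgV V) Φ))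
    {μ : Literature.NumberTheory.Automorphic.IdeleClassGroup L →ₜ* Circle} (hμ : IdeleClassGroup.IsConjugateSymplectic (L : Type) μ)
    (hw : IdeleClassGroup.HasWeight (L : Type) μ 1) (Car : Def45.Carriers (L : Type) μ)
    (hΦμ : ι₁ ∈ hμ.cmType.1) (Dμ : ObjOne (AlgHom.id ℚ (L : Type)) ι₁ hμ hw Car) :
    letI := ((starRingEnd ℂ).comp ι₁).toAlgebra
    ∃ (M : (toThm418Data _ (U.rest (restTailOne (AlgHom.id ℚ (L : Type)) ι₁ hμ hw Car
          ((Model.sec42DataOf_heckeTranslates hU7 h (pkgV V) Φ iso h4).rhoΩOne (AlgHom.id ℚ (L : Type)) ι₁ hμ hw Car)))).Map43RationalData)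
      (jH : M.HB →ₗ[ℂ] (LiuDictionary.ofTower hHD hI h₁ h₃ hA V Unit (fun _ => Unit) (fun _ _ => PUnit) (fun _ => True)
            (fun _ d => d.IsReflexOfTypeG ((starRingEnd ℂ).comp ι₁) hμ.cmType)).H),
      Function.Injective jH ∧
      (∀ (g : ↥V.adelicFin) (x : M.HB), jH (M.ρB g x) = MonoidAlgebra.of ℂ ↥V.adelicFin g • jH x) ∧
      ∀ (K : HodgeCM.Level V), K ≤ HodgeCM.Level.capThree (V := V)
          ((Model.sec42DataOf h iso (pkgF L) ι₁ (pkgV V) Φ).S.K₀.1 : Subgroup ↥V.adelicFin) (Model.sec42DataOf h iso (pkgF L) ι₁ (pkgV V) Φ).S.K₀.2.1 →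
        Nonempty (HcmPieces.{0, 1, 0} (toThm418Data _ (U.rest (restTailOne (AlgHom.id ℚ (L : Type)) ι₁ hμ hw Car
          ((Model.sec42DataOf_heckeTranslates hU7 h (pkgV V) Φ iso h4).rhoΩOne (AlgHom.id ℚ (L : Type)) ι₁ hμ hw Car))))
          M (LiuDictionary.ofTower hHD hI h₁ h₃ hA V Unit (fun _ => Unit) (fun _ _ => PUnit) (fun _ => True)
            (fun _ d => d.IsReflexOfTypeG ((starRingEnd ℂ).comp ι₁) hμ.cmType)).H jH K.K
          ((HodgeCM.Model.picardCMUniverse hHD hI h₁ h₃).CohC ((HodgeCM.Model.picardCMUniverse hHD hI h₁ h₃).pms L ι₁ V K) 1)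
          (resTotal hHD hI (ballQuotientUniformisedDatum_of h₁) h₃ hA K)
          ((LiuDictionary.ofTower hHD hI h₁ h₃ hA V Unit (fun _ => Unit) (fun _ _ => PUnit) (fun _ => True)
            (fun _ d => d.IsReflexOfTypeG ((starRingEnd ℂ).comp ι₁) hμ.cmType)).cmClasses K ())) := by
  letI := ((starRingEnd ℂ).comp ι₁).toAlgebra
  exact ⟨map43RecordAtPin (componentAlbanesePinTotal hHD hI (ballQuotientUniformisedDatum_of h₁) h₃ hA hU7 V h h4
        (Summit.HodgeConjecture.CorCM.D2Bridge.PiecesByValueConj.comp_cmConjRingHom_eq_of_starRingEnd (ι₁ := ι₁)) Φ iso)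
      (AlgHom.id ℚ (L : Type)) ι₁ hμ hw Car U.Eps U.epsOf U.Chi (U.omega μ hμ) (U.rho μ hμ) Dμ ι₁ hΦμ,
    jHPin (componentAlbanesePinTotal hHD hI (ballQuotientUniformisedDatum_of h₁) h₃ hA hU7 V h h4
        (Summit.HodgeConjecture.CorCM.D2Bridge.PiecesByValueConj.comp_cmConjRingHom_eq_of_starRingEnd (ι₁ := ι₁)) Φ iso)
      (AlgHom.id ℚ (L : Type)) ι₁ hμ hw Car U.Eps U.epsOf U.Chi (U.omega μ hμ) (U.rho μ hμ) Dμ ι₁ hΦμ,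
    jHPin_injective _ (AlgHom.id ℚ (L : Type)) ι₁ hμ hw Car U.Eps U.epsOf U.Chi (U.omega μ hμ) (U.rho μ hμ) Dμ ι₁ hΦμ,
    fun g x => jHPin_comm _ (AlgHom.id ℚ (L : Type)) ι₁ hμ hw Car U.Eps U.epsOf U.Chi (U.omega μ hμ) (U.rho μ hμ) Dμ ι₁ hΦμ g x,
    fun K hK => nonempty_hcmPieces_atUniformRest_conjInst Unit (fun _ => Unit) (fun _ _ => PUnit) (fun _ => True)
      (fun _ d => d.IsReflexOfTypeG ((starRingEnd ℂ).comp ι₁) hμ.cmType) hμ hw Car h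
      (Model.sec42DataOf h iso (pkgF L) ι₁ (pkgV V) Φ) (Model.sec42DataOf_heckeTranslates hU7 h (pkgV V) Φ iso h4) (fun _ => rfl) U _
      (componentAlbanesePinTotal_levelLaw hHD hI (ballQuotientUniformisedDatum_of h₁) h₃ hA hU7 V h h4
        (Summit.HodgeConjecture.CorCM.D2Bridge.PiecesByValueConj.comp_cmConjRingHom_eq_of_starRingEnd (ι₁ := ι₁)) Φ iso)
      Dμ ι₁ hΦμ () K hK fun _ hd => hd⟩

end HeadPhiMu

end Summit.HodgeConjecture.CorCM.D2Bridge.NotHJ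

end
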